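import Literature.NumberTheory.Automorphic.SatakeParameterGenericBound
import Literature.NumberTheory.Automorphic.SatakeParameterRankTwoBound
import Literature.NumberTheory.Automorphic.CartanDecompositionGLnPowers
import Literature.NumberTheory.Automorphic.WhittakerModelsProofs
import Literature.NumberTheory.Automorphic.WhittakerBesselGL2
import Literature.NumberTheory.Automorphic.MatrixCoefficientsProofs
import HarnessLib

/-!
# Jacquet–Shalika's Cor. (2.5) for `GL₂`: `|a| < q^{1/2}` for unitary generic unramified `π`

Topic `NumberTheory/Automorphic`; proof file (theorems only, no definition, no named fact) for the
named fact `JacquetShalika1981_norm_lt_sqrt_of_isGeneric` of `SatakeParameterGenericBound`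
(Jacquet–Shalika, *On Euler products and the classification of automorphic representations I*,
Amer. J. Math. **103** (1981), Cor. (2.5) p. 515) in rank `n = 2`, proved here unconditionally:

* `JacquetShalika1981_norm_lt_sqrt_of_isGeneric_two (ρ : Representation ℂ (GL (Fin 2) F) V) :
  JacquetShalika1981_norm_lt_sqrt_of_isGeneric ρ`.

## The argument (elementary; no principal series, no intertwining operators)

Let `B` be the invariant positive-definite Hermitian form (`IsUnitarizable`), read as an inner
product on `V` (`InnerProductSpace.Core`), `v ≠ 0` the spherical Hecke eigenvector of
`IsSatakeParameter ρ ϖ {a, b}`: `T₁ v = q^{1/2}(a + b) v`, `T₂ v = ab v`, `K = GL₂(𝒪)`,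
`t = diag(ϖ, 1)`, `z = ϖ · 1`.

1. `|ab| = 1` (`T₂ = ρ(z)` on `V^K`, `heckeT_self_apply`; unimodular eigenvalues,
   `IsUnitarizable.norm_eq_one_of_apply_eq_smul`), `|q^{1/2}(a+b)| ≤ q + 1` (`T₁` is a sum of
   `q + 1` isometries, `ncard_orbit_glInt_heckeDiag_two_one`,
   `norm_le_ncard_orbit_of_heckeOperator_apply_eq_smul`) and `a + b = ab \overline{(a + b)}`
   (`⟪T₁ v, v⟫ = (q+1) ⟪ρ(t) v, v⟫` and `w t w⁻¹ = t⁻¹ z` for the Weyl element `w ∈ K`), exactly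
   as in `SatakeParameterRankTwoBound` but for an abstract unitarizable `ρ`; this already gives
   `|a|, |b| ≤ q^{1/2}` (`norm_le_of_norm_mul_eq_one_of_eq_mul_conj`).
2. **Strictness needs genericity.** If `|q^{1/2}(a + b)| = q + 1`, the `q + 1` unit vectors
   `ρ(y) v`, `yK ⊆ KtK`, sum to a vector of norm `(q+1)‖v‖`, so they are all equal
   (`eq_smul_of_sum_eq_smul_of_norm_eq_card`, equality in the triangle inequality of a Hilbert
   space); hence `ρ(t) v = c v`. With `K` fixing `v` and the Cartan decomposition
   `GL₂(F) = ⨆ K ϖ^a K` (`exists_glInt_mul_mul_eq_zpowDiagGL`, `ϖ^a = t^{a₁ - a₂} z^{a₂}`), every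
   `g ∈ GL₂(F)` acts on `v` by a scalar, so commutators act trivially, and
   `n(x) = t n(y) t⁻¹ n(y)⁻¹` (`y = x/(ϖ - 1)`) shows that `N₂(F)` fixes `v`. A non-zero Whittaker
   functional `Λ` has `Λ(ρ(g) v) ≠ 0` for some `g` (`whittakerModel_injective_of_ne_zero`), so
   `Λ v ≠ 0` and `Λ v = Λ(ρ(n(x)) v) = ψ(x) Λ v` forces `ψ = 1`, contradicting the non-triviality
   of `ψ`. (In print: the spherical unitary dual of `GL₂(F)` consists of the one-dimensional
   representations `χ ∘ det`, which "do not have Whittaker models", and the `π(χ₁, χ₂)` with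
   `|α_i| = 1` or `{α₁, α₂} = {α q^s, α q^{-s}}`, `-1/2 < s < 1/2`; Bump (1997), §3.5 and
   Prop. 4.6.12–4.6.13.)
3. So `|q^{1/2}(a+b)| < q + 1`, and `norm_lt_of_norm_mul_eq_one_of_eq_mul_conj` gives
   `|a|, |b| < q^{1/2}`.

## References

* H. Jacquet, J. A. Shalika, *On Euler products and the classification of automorphic
  representations I*, Amer. J. Math. 103 (1981), Cor. (2.5) p. 515 [JacquetShalikaAJM1981].
* D. Bump, *Automorphic Forms and Representations* (1997), §3.5 (spherical principal series and
  their Satake parameters; "the one dimensional representations … do not have Whittaker models";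
  unitary `π(χ₁, χ₂)`: `|α_i| = 1` or `α q^{±s}`, `-1/2 < s < 1/2`), §4.6, Prop. 4.6.12–4.6.13
  [Bump1997].
-/

noncomputable section

open scoped MatrixGroups ComplexConjugate InnerProductSpace
open ValuativeRel Complex
open Literature.NumberTheory.GaloisRepresentations.IsNonarchimedeanLocalField

namespace Literature.NumberTheory.Automorphic

/-! ### The strict elementary endgame -/

section Elementary

/-- **Strict form of `norm_le_of_norm_mul_eq_one_of_eq_mul_conj`.** If `a, b ∈ ℂ` satisfy
`|ab| = 1`, `a + b = ab(\bar a + \bar b)` and `|a + b| < s + s⁻¹` with `s > 1`, then `|a| < s`: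
if `|a| = r ≥ s`, the symmetry gives `|a + b| = r + r⁻¹ ≥ s + s⁻¹`. [folklore] -/
theorem norm_lt_of_norm_mul_eq_one_of_eq_mul_conj {a b : ℂ} {s : ℝ} (hs : 1 < s)
    (h2 : ‖a * b‖ = 1) (h1 : ‖a + b‖ < s + s⁻¹) (hsym : a + b = a * b * conj (a + b)) :
    ‖a‖ < s := by
  by_contra hle
  rw [not_lt] at hle
  set r : ℝ := ‖a‖ with hr
  have hs0 : 0 < s := one_pos.trans hs
  have hr1 : 1 < r := hs.trans_le hle
  have hr0 : 0 < r := one_pos.trans hr1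
  have hna : Complex.normSq a = r ^ 2 := by rw [Complex.normSq_eq_norm_sq]
  have hnab : Complex.normSq a * Complex.normSq b = 1 := by
    rw [← Complex.normSq_mul, Complex.normSq_eq_norm_sq, h2, one_pow]
  have hnb : Complex.normSq b = (r ^ 2)⁻¹ := by
    rw [← hna]
    exact (inv_eq_of_mul_eq_one_right hnab).symm
  have ha : a * conj a = (Complex.normSq a : ℂ) := Complex.mul_conj a
  have hb : b * conj b = (Complex.normSq b : ℂ) := Complex.mul_conj b
  have hsym' : a + b = a * b * conj a + a * b * conj b := by rw [hsym, map_add, mul_add]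
  have key : ((Complex.normSq a : ℂ) - 1) * (a + b) =
      a * ((Complex.normSq a : ℂ) - (Complex.normSq b : ℂ)) := by
    linear_combination -hsym' - b * ha - a * hb
  have hnorm : (r ^ 2 - 1) * ‖a + b‖ = r * (r ^ 2 - (r ^ 2)⁻¹) := by
    have h := congrArg norm key
    rw [norm_mul, norm_mul, hna, hnb, ← Complex.ofReal_one, ← Complex.ofReal_sub,
      ← Complex.ofReal_sub, Complex.norm_real, Complex.norm_real,
      Real.norm_of_nonneg (by nlinarith), Real.norm_of_nonneg, ← hr] at h
    · exact h
    · rw [sub_nonneg]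
      calc (r ^ 2)⁻¹ ≤ 1 := inv_le_one_of_one_le₀ (by nlinarith)
        _ ≤ r ^ 2 := by nlinarith
  have hE : ‖a + b‖ = r + r⁻¹ := by
    have hne : r ^ 2 - 1 ≠ 0 := by nlinarith
    refine mul_left_cancel₀ hne ?_
    rw [hnorm]
    field_simp
    ring
  have hle' : s + s⁻¹ ≤ r + r⁻¹ := by
    rw [← sub_nonneg]
    have : r + r⁻¹ - (s + s⁻¹) = (r - s) * (r * s - 1) / (r * s) := by
      field_simp
      ring
    rw [this]
    exact div_nonneg (mul_nonneg (sub_nonneg.2 hle) (by nlinarith)) (mul_pos hr0 hs0).le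
  rw [hE] at h1
  exact absurd (hle'.trans_lt h1) (lt_irrefl _)

end Elementary

/-! ### Equality in the triangle inequality of a Hilbert space -/

section Hilbert

variable {E : Type*} [NormedAddCommGroup E] [InnerProductSpace ℂ E]

/-- **Equality in the triangle inequality.** If vectors `u y`, `y ∈ s`, all of norm `‖v‖`, sum to
`c • v` with `|c| = #s`, then every `u y` equals `(c/#s) • v`: with `w = (c/#s) v`,
`∑_y re ⟪u y, w⟫ = re ⟪c v, w⟫ = #s ‖v‖²` while each term is `≤ ‖u y‖ ‖w‖ = ‖v‖²`, so each term
is `‖v‖²` and `‖u y - w‖² = 0`. [folklore] -/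
theorem eq_smul_of_sum_eq_smul_of_norm_eq_card {ι : Type*} {s : Finset ι} {u : ι → E} {v : E}
    (hu : ∀ y ∈ s, ‖u y‖ = ‖v‖) {c : ℂ} (hsum : ∑ y ∈ s, u y = c • v) (hc : ‖c‖ = s.card)
    (hs : s.Nonempty) : ∀ y ∈ s, u y = (c / s.card) • v := by
  set N : ℕ := s.card with hN
  have hN0 : (0 : ℝ) < N := by exact_mod_cast hs.card_pos
  have hNC : (N : ℂ) ≠ 0 := by exact_mod_cast hs.card_pos.ne'
  set w : E := (c / N) • v with hw_def
  have hcN : ‖c / (N : ℂ)‖ = 1 := by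
    rw [norm_div, hc, Complex.norm_natCast, div_self hN0.ne']
  have hw : ‖w‖ = ‖v‖ := by rw [hw_def, norm_smul, hcN, one_mul]
  -- the sum of the real parts
  have hre : ∑ y ∈ s, RCLike.re ⟪u y, w⟫_ℂ = N * ‖v‖ ^ 2 := by
    rw [← map_sum, ← sum_inner, hsum, hw_def, inner_smul_left, inner_smul_right, ← mul_assoc]
    have h1 : (starRingEnd ℂ) c * (c / N) = (N : ℂ) := by
      rw [mul_div_assoc', Complex.conj_mul', hc]
      push_cast
      field_simp
    rw [h1, RCLike.re_to_complex, ← Complex.ofReal_natCast, Complex.re_ofReal_mul]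
    congr 1
    exact inner_self_eq_norm_sq (𝕜 := ℂ) v
  -- each term is at most `‖v‖²`
  have hle : ∀ y ∈ s, RCLike.re ⟪u y, w⟫_ℂ ≤ ‖v‖ ^ 2 := fun y hy => by
    calc RCLike.re ⟪u y, w⟫_ℂ ≤ ‖u y‖ * ‖w‖ := re_inner_le_norm _ _
      _ = ‖v‖ ^ 2 := by rw [hu y hy, hw, sq]
  have hzero : ∑ y ∈ s, (‖v‖ ^ 2 - RCLike.re ⟪u y, w⟫_ℂ) = 0 := by
    rw [Finset.sum_sub_distrib, hre, Finset.sum_const, nsmul_eq_mul, sub_self]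
  have heach := (Finset.sum_eq_zero_iff_of_nonneg fun y hy => sub_nonneg.2 (hle y hy)).1 hzero
  intro y hy
  have hy' : RCLike.re ⟪u y, w⟫_ℂ = ‖v‖ ^ 2 := by linarith [heach y hy, hle y hy]
  have hsq : ‖u y - w‖ ^ 2 = 0 := by
    rw [@norm_sub_sq ℂ, hy', hu y hy, hw]
    ring
  rw [← sub_eq_zero]
  exact norm_eq_zero.1 (pow_eq_zero_iff two_ne_zero |>.1 hsq)

end Hilbert

/-! ### Cor. (2.5) for `GL₂` -/

section RankTwo

variable {F : Type} [Field F] [ValuativeRel F] [TopologicalSpace F] [IsNonarchimedeanLocalField F]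
variable {V : Type*} [AddCommGroup V] [Module ℂ V]

/-- If `g` acts on `v` by the non-zero scalar `d`, then `g⁻¹` acts on `v` by `d⁻¹`. [folklore] -/
theorem apply_inv_eq_inv_smul_of_apply_eq_smul {G W : Type*} [Group G] [AddCommGroup W]
    [Module ℂ W] (ρ : Representation ℂ G W) {g : G} {v : W} {d : ℂ} (hd : d ≠ 0)
    (hg : ρ g v = d • v) : ρ g⁻¹ v = d⁻¹ • v := by
  calc ρ g⁻¹ v = ρ g⁻¹ (d⁻¹ • (d • v)) := by rw [smul_smul, inv_mul_cancel₀ hd, one_smul]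
    _ = d⁻¹ • ρ g⁻¹ (ρ g v) := by rw [map_smul, hg]
    _ = d⁻¹ • v := by
        rw [← Module.End.mul_apply, ← map_mul, inv_mul_cancel, map_one, Module.End.one_apply]

omit [ValuativeRel F] [TopologicalSpace F] [IsNonarchimedeanLocalField F] in
/-- `ϖ^a = t^{a₀ - a₁} z^{a₁}` in `GL₂(F)`, `t = diag(ϖ, 1)`, `z = ϖ · 1` (`heckeDiag`).
[folklore] -/
theorem zpowDiagGL_two_eq (ϖ : Fˣ) (a : Fin 2 → ℤ) :
    zpowDiagGL (n := 2) ϖ.ne_zero a =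
      heckeDiag 2 ϖ 1 ^ (a 0 - a 1) * heckeDiag 2 ϖ 2 ^ (a 1) := by
  -- `m ↦ ϖ^m` as a monoid homomorphism out of `Multiplicative ℤ²`
  let φ : Multiplicative (Fin 2 → ℤ) →* GL (Fin 2) F :=
    { toFun := fun m => zpowDiagGL (n := 2) ϖ.ne_zero (Multiplicative.toAdd m)
      map_one' := zpowDiagGL_zero _
      map_mul' := fun x y => zpowDiagGL_add _ _ _ }
  have hφ : ∀ m : Fin 2 → ℤ, zpowDiagGL (n := 2) ϖ.ne_zero m = φ (Multiplicative.ofAdd m) :=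
    fun m => rfl
  have ht : zpowDiagGL (n := 2) ϖ.ne_zero ![1, 0] = heckeDiag 2 ϖ 1 := by
    refine Units.ext ?_
    rw [coe_zpowDiagGL, coe_heckeDiag]
    congr 1
    funext j
    fin_cases j <;> simp
  have hz : zpowDiagGL (n := 2) ϖ.ne_zero ![1, 1] = heckeDiag 2 ϖ 2 := by
    refine Units.ext ?_
    rw [coe_zpowDiagGL, coe_heckeDiag]
    congr 1
    funext j
    fin_cases j <;> simp
  have ha : a = (a 0 - a 1) • ![1, 0] + (a 1) • ![1, 1] := by
    funext j
    fin_cases j <;> simp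
  calc zpowDiagGL (n := 2) ϖ.ne_zero a
      = φ (Multiplicative.ofAdd ((a 0 - a 1) • ![1, 0] + (a 1) • ![1, 1])) := by
        rw [← ha]; exact hφ a
    _ = φ (Multiplicative.ofAdd ![1, 0]) ^ (a 0 - a 1) * φ (Multiplicative.ofAdd ![1, 1]) ^ (a 1) := by
        rw [ofAdd_add, map_mul, ofAdd_zsmul, ofAdd_zsmul, map_zpow, map_zpow]
    _ = _ := by rw [← hφ, ← hφ, ht, hz]

omit [ValuativeRel F] [TopologicalSpace F] [IsNonarchimedeanLocalField F] in
/-- `diag(ϖ, 1) n(y) diag(ϖ, 1)⁻¹ n(y)⁻¹ = n((ϖ - 1) y)`: every element of `N₂(F)` is a commutator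
of the torus element `t = diag(ϖ, 1)` (`ϖ ≠ 1`) with an element of `N₂(F)`. [folklore] -/
theorem heckeDiag_mul_unipotentGL2_mul_inv_mul_inv (ϖ : Fˣ) (y : F) :
    heckeDiag 2 ϖ 1 * ((unipotentGL2 y : ↥(upperUnitriangular (Fin 2) F)) : GL (Fin 2) F) *
        (heckeDiag 2 ϖ 1)⁻¹ *
        ((unipotentGL2 y : ↥(upperUnitriangular (Fin 2) F)) : GL (Fin 2) F)⁻¹ =
      ((unipotentGL2 (((ϖ : F) - 1) * y) : ↥(upperUnitriangular (Fin 2) F)) : GL (Fin 2) F) := by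
  have ht : heckeDiag 2 ϖ 1 = diagGL2 ϖ 1 := by
    refine Units.ext ?_
    rw [coe_heckeDiag, coe_diagGL2]
    ext i j
    fin_cases i <;> fin_cases j <;> simp
  have hinv : ((unipotentGL2 y : ↥(upperUnitriangular (Fin 2) F)) : GL (Fin 2) F)⁻¹ =
      ((unipotentGL2 (-y) : ↥(upperUnitriangular (Fin 2) F)) : GL (Fin 2) F) := by
    rw [inv_eq_iff_mul_eq_one, ← Subgroup.coe_mul, ← unipotentGL2_add, add_neg_cancel,
      unipotentGL2_zero, Subgroup.coe_one]
  rw [ht, diagGL2_mul_unipotentGL2_mul_inv, hinv, ← Subgroup.coe_mul, ← unipotentGL2_add]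
  congr 2
  ring

/-- **Jacquet–Shalika (1981), Cor. (2.5), for `GL₂`.** An irreducible admissible unitarizable
representation of `GL₂(F)` which is generic (for a non-trivial continuous `ψ`) and unramified with
Satake parameter `{a, b}` at a uniformizer `ϖ` has `|a|, |b| < q^{1/2}`. Proof as in the module
docstring: unitarity gives `|ab| = 1`, `|q^{1/2}(a+b)| ≤ q + 1` and `a + b = ab\overline{(a+b)}`,
whence `|a|, |b| ≤ q^{1/2}`; equality would make the `q + 1` unit vectors `ρ(y) v`, `yK ⊆ KtK`,
equal (equality in the triangle inequality), so `t = diag(ϖ, 1)` and then (Cartan decomposition)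
all of `GL₂(F)` would act on the spherical vector by scalars, `N₂(F)` (commutators `t n t⁻¹ n⁻¹`)
trivially, and a Whittaker functional would force `ψ = 1`. In print: the unitary spherical
representations of `GL₂(F)` are the one-dimensional `χ ∘ det` (no Whittaker model) and the
`π(χ₁, χ₂)` with `|α_i| = 1` or `{α q^s, α q^{-s}}`, `|s| < 1/2` (Bump (1997), §3.5,
Prop. 4.6.12–4.6.13); admissibility is not used.
[cite: JacquetShalikaAJM1981, Cor. (2.5) p. 515] [cite: Bump1997, §3.5 and Prop. 4.6.12–4.6.13] -/
theorem JacquetShalika1981_norm_lt_sqrt_of_isGeneric_two (ρ : Representation ℂ (GL (Fin 2) F) V) :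
    JacquetShalika1981_norm_lt_sqrt_of_isGeneric ρ := by
  intro _ _ _ hu ψ hψ hgen ϖ hϖ α hα a₀ ha₀
  classical
  obtain ⟨hcard, v, hvK, hv0, hT⟩ := hα
  -- notation
  set q : ℕ := residueFieldCard F with hq_def
  set sq : ℝ := Real.sqrt (q : ℝ) with hsq_def
  set Kv : Subgroup (GL (Fin 2) F) := glInt 2 F with hKv
  set t : GL (Fin 2) F := heckeDiag 2 ϖ 1 with ht_def
  set z : GL (Fin 2) F := heckeDiag 2 ϖ 2 with hz_def
  have hq1 : 1 < q := one_lt_residueFieldCard F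
  have hsq1 : 1 < sq := by
    rw [hsq_def, Real.lt_sqrt zero_le_one, one_pow]
    exact_mod_cast hq1
  have hsq0 : 0 < sq := one_pos.trans hsq1
  have hsq2 : (q : ℝ) = sq ^ 2 := by rw [hsq_def, Real.sq_sqrt (Nat.cast_nonneg _)]
  have hsqC : ((sq : ℝ) : ℂ) ≠ 0 := by exact_mod_cast hsq0.ne'
  -- the eigenvalue equations
  set lam : ℂ := ((sq : ℝ) : ℂ) * α.esymm 1 with hlam
  have hT1 : heckeOperator ρ Kv t v = lam • v := by
    have h := hT 1 (by norm_num)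
    rw [show 1 * (2 - 1) = 1 from rfl, pow_one, heckeT_def] at h
    exact h
  have hρz : ρ z v = α.esymm 2 • v := by
    have h := hT 2 le_rfl
    rw [show 2 * (2 - 2) = 0 from rfl, pow_zero, Complex.ofReal_one, one_mul,
      heckeT_self_apply ρ ϖ hvK] at h
    exact h
  -- (1) `|e₂| = 1`
  have he2 : ‖α.esymm 2‖ = 1 := hu.norm_eq_one_of_apply_eq_smul hv0 hρz
  have he2ne : α.esymm 2 ≠ 0 := fun h => by simp [h] at he2
  -- the inner product space structure defined by the invariant form
  obtain ⟨B, hBsymm, hBpos, hBinv⟩ := hu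
  have hB0 : ∀ x : V, B x x = 0 → x = 0 := fun x hx => by
    by_contra h
    have := hBpos x h
    rw [hx, Complex.zero_re] at this
    exact lt_irrefl _ this
  let cd : InnerProductSpace.Core ℂ V :=
    { inner := fun x y => B x y
      conj_inner_symm := fun x y => hBsymm.eq y x
      re_inner_nonneg := fun x => by
        by_cases hx : x = 0
        · simp [hx]
        · exact (hBpos x hx).le
      add_left := fun x y z => by simp
      smul_left := fun x y r => by simp
      definite := hB0 }
  letI : NormedAddCommGroup V := cd.toNormedAddCommGroup
  letI : InnerProductSpace ℂ V := InnerProductSpace.ofCore cd.toCore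
  have hiso : ∀ (g : GL (Fin 2) F) (x : V), ‖ρ g x‖ = ‖x‖ := by
    intro g x
    change √(RCLike.re (B (ρ g x) (ρ g x))) = √(RCLike.re (B x x))
    rw [hBinv]
  have hadj : ∀ (g : GL (Fin 2) F) (x y : V), ⟪ρ g x, y⟫_ℂ = ⟪x, ρ g⁻¹ y⟫_ℂ := by
    intro g x y
    have h1 : ρ g (ρ g⁻¹ y) = y := by
      rw [← Module.End.mul_apply, ← map_mul, mul_inv_cancel, map_one, Module.End.one_apply]
    calc ⟪ρ g x, y⟫_ℂ = ⟪ρ g x, ρ g (ρ g⁻¹ y)⟫_ℂ := by rw [h1]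
      _ = ⟪x, ρ g⁻¹ y⟫_ℂ := hBinv g x _
  have hfix : ∀ k ∈ Kv, ρ k v = v := fun k hk => (Representation.mem_fixedPoints _ _ _).1 hvK k hk
  -- (2) the transversal of `K t K / K` and its size `q + 1`
  haveI : Fintype 𝓀[F] := Fintype.ofFinite _
  have hϖ' : IsUniformizingElement ((ϖ : Fˣ) : F) := isUniformizingElement_of_isUniformizer hϖ
  have hqcard : Fintype.card 𝓀[F] = q := by
    rw [hq_def, residueFieldCard, Nat.card_eq_fintype_card]
  have hbij := bijOn_heckeTransversal (n := 2) hϖ' (r := 1) (by norm_num)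
  rw [Units.mk0_val] at hbij
  set s : Finset (GL (Fin 2) F) := heckeTransversal (n := 2) hϖ'.ne_zero 1 with hs_def
  have hscard : s.card = q + 1 := by
    have h1 : s.card = Fintype.card (TransversalIndex 2 F 1) :=
      (Finset.card_image_of_injective _ (TransversalIndex.rep_injective hϖ')).trans
        Finset.card_univ
    rw [h1, card_transversalIndex_two_one, hqcard]
  have hsne : s.Nonempty := by
    rw [← Finset.card_pos, hscard]
    exact Nat.succ_pos _
  have hcount : (MulAction.orbit Kv (t : GL (Fin 2) F ⧸ Kv)).ncard = q + 1 := by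
    rw [← hbij.image_eq, hbij.injOn.ncard_image, Set.ncard_coe_finset, hscard]
  have hbound : ‖lam‖ ≤ (q : ℝ) + 1 := by
    have h := norm_le_ncard_orbit_of_heckeOperator_apply_eq_smul ρ (fun g y => (hiso g y).le)
      Kv t hv0 hT1
    rw [hcount] at h
    exact_mod_cast h
  -- (3) the unitarity symmetry `lam = e₂ conj lam`
  have hTsum : heckeOperator ρ Kv t v = ∑ y ∈ s, ρ y v :=
    heckeOperator_apply_eq_sum ρ Kv t s hbij hvK
  have hsumv : ∑ y ∈ s, ρ y v = lam • v := by rw [← hTsum, hT1]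
  have hterm : ∀ y ∈ s, ⟪ρ y v, v⟫_ℂ = ⟪ρ t v, v⟫_ℂ := by
    intro y hy
    have hy' := (mk_mem_orbit_iff Kv t y).1 (hbij.mapsTo (Finset.mem_coe.2 hy))
    obtain ⟨k, hk, k', hk', rfl⟩ := DoubleCoset.mem_doubleCoset.1 hy'
    rw [map_mul, map_mul, Module.End.mul_apply, Module.End.mul_apply, hfix k' hk', hadj,
      hfix k⁻¹ (inv_mem hk)]
  have hinnerT : ⟪heckeOperator ρ Kv t v, v⟫_ℂ = (s.card : ℂ) * ⟪ρ t v, v⟫_ℂ := by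
    rw [hTsum, sum_inner, Finset.sum_congr rfl hterm, Finset.sum_const, nsmul_eq_mul]
  have hX1 : conj lam * ⟪v, v⟫_ℂ = (s.card : ℂ) * ⟪ρ t v, v⟫_ℂ := by
    rw [← hinnerT, hT1, inner_smul_left]
  obtain ⟨σ, hσ⟩ := exists_perm_lt_iff_not_mem (n := 2) (r := 1) (S := ({0} : Finset (Fin 2)))
    (by norm_num) (by decide)
  set w : GL (Fin 2) F := permGL σ with hw
  have hwK : w ∈ Kv := permGL_mem_glInt σ
  have hwt : w * t = piPowGL ϖ.ne_zero (epsOf ({0} : Finset (Fin 2))) * w :=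
    permGL_mul_heckeDiag hσ ϖ
  have htt' : t * piPowGL ϖ.ne_zero (epsOf ({0} : Finset (Fin 2))) = z := by
    refine Units.ext ?_
    rw [Units.val_mul, ht_def, hz_def, coe_heckeDiag, coe_heckeDiag, coe_piPowGL]
    unfold Echelon.piPow
    rw [Matrix.diagonal_mul_diagonal]
    congr 1
    funext j
    fin_cases j <;> simp [epsOf]
  have ht' : piPowGL ϖ.ne_zero (epsOf ({0} : Finset (Fin 2))) = t⁻¹ * z := by
    rw [← htt', inv_mul_cancel_left]
  have hconjX : conj ⟪ρ t v, v⟫_ℂ = α.esymm 2 * ⟪ρ t v, v⟫_ℂ := by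
    calc conj ⟪ρ t v, v⟫_ℂ = ⟪v, ρ t v⟫_ℂ := inner_conj_symm v (ρ t v)
      _ = ⟪ρ w⁻¹ v, ρ t v⟫_ℂ := by rw [hfix w⁻¹ (inv_mem hwK)]
      _ = ⟪v, ρ w (ρ t v)⟫_ℂ := by rw [hadj, inv_inv]
      _ = ⟪v, ρ w (ρ t (ρ w⁻¹ v))⟫_ℂ := by rw [hfix w⁻¹ (inv_mem hwK)]
      _ = ⟪v, ρ (w * t * w⁻¹) v⟫_ℂ := by
          rw [map_mul, map_mul, Module.End.mul_apply, Module.End.mul_apply]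
      _ = ⟪v, ρ (t⁻¹ * z) v⟫_ℂ := by rw [hwt, mul_inv_cancel_right, ht']
      _ = ⟪v, ρ t⁻¹ (ρ z v)⟫_ℂ := by rw [map_mul, Module.End.mul_apply]
      _ = α.esymm 2 * ⟪v, ρ t⁻¹ v⟫_ℂ := by rw [hρz, map_smul, inner_smul_right]
      _ = α.esymm 2 * ⟪ρ t v, v⟫_ℂ := by rw [← hadj]
  have hxx : ⟪v, v⟫_ℂ ≠ 0 := inner_self_ne_zero.2 hv0
  have hlam_symm : lam = α.esymm 2 * conj lam := by
    have h := congrArg conj hX1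
    rw [map_mul, Complex.conj_conj, inner_self_conj, map_mul, Complex.conj_natCast, hconjX] at h
    have h2 : lam * ⟪v, v⟫_ℂ = α.esymm 2 * conj lam * ⟪v, v⟫_ℂ := by
      rw [h, mul_assoc (α.esymm 2), hX1]
      ring
    exact mul_right_cancel₀ hxx h2
  have he1 : α.esymm 1 = α.esymm 2 * conj (α.esymm 1) := by
    have h := hlam_symm
    rw [hlam, map_mul, Complex.conj_ofReal] at h
    have h2 : ((sq : ℝ) : ℂ) * α.esymm 1 = ((sq : ℝ) : ℂ) * (α.esymm 2 * conj (α.esymm 1)) := by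
      rw [h]
      ring
    exact mul_left_cancel₀ hsqC h2
  -- (4) strictness of the trivial bound, from genericity
  have hstrict : ‖lam‖ < (q : ℝ) + 1 := by
    refine lt_of_le_of_ne hbound fun heq => ?_
    -- all the `ρ(y) v`, `y ∈ s`, coincide with `c • v`
    have hcardC : ‖lam‖ = s.card := by rw [heq, hscard]; push_cast; ring
    have hall := eq_smul_of_sum_eq_smul_of_norm_eq_card (fun y _ => hiso y v) hsumv hcardC hsne
    set c : ℂ := lam / s.card with hc_def
    have hc1 : ‖c‖ = 1 := by
      have hN0 : (0 : ℝ) < s.card := by exact_mod_cast hsne.card_pos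
      rw [hc_def, norm_div, hcardC, Complex.norm_natCast, div_self hN0.ne']
    have hc0 : c ≠ 0 := fun h => by simp [h] at hc1
    -- `t` acts on `v` by `c`
    have htv : ρ t v = c • v := by
      obtain ⟨y, hy, hyt⟩ := hbij.surjOn (MulAction.mem_orbit_self _)
      have hk : y⁻¹ * t ∈ Kv := QuotientGroup.eq.1 hyt
      calc ρ t v = ρ (y * (y⁻¹ * t)) v := by rw [mul_inv_cancel_left]
        _ = ρ y v := by rw [map_mul, Module.End.mul_apply, hfix _ hk]
        _ = c • v := hall y hy
    -- the subgroup of elements acting on `v` by a non-zero scalar is everything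
    let H : Subgroup (GL (Fin 2) F) :=
      { carrier := {g | ∃ d : ℂ, d ≠ 0 ∧ ρ g v = d • v}
        one_mem' := ⟨1, one_ne_zero, by rw [map_one, Module.End.one_apply, one_smul]⟩
        mul_mem' := by
          rintro g h ⟨d, hd, hg⟩ ⟨d', hd', hh⟩
          exact ⟨d' * d, mul_ne_zero hd' hd, by
            rw [map_mul, Module.End.mul_apply, hh, map_smul, hg, smul_smul]⟩
        inv_mem' := by
          rintro g ⟨d, hd, hg⟩
          exact ⟨d⁻¹, inv_ne_zero hd, apply_inv_eq_inv_smul_of_apply_eq_smul ρ hd hg⟩ }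
    have hHmem : ∀ {g : GL (Fin 2) F}, g ∈ H ↔ ∃ d : ℂ, d ≠ 0 ∧ ρ g v = d • v := Iff.rfl
    have hKH : Kv ≤ H := fun k hk => hHmem.2 ⟨1, one_ne_zero, by rw [hfix k hk, one_smul]⟩
    have htH : t ∈ H := hHmem.2 ⟨c, hc0, htv⟩
    have hzH : z ∈ H := hHmem.2 ⟨α.esymm 2, he2ne, hρz⟩
    have hH : ∀ g : GL (Fin 2) F, g ∈ H := by
      intro g
      obtain ⟨k₁, hk₁, k₂, hk₂, a, -, hg⟩ := exists_glInt_mul_mul_eq_zpowDiagGL hϖ' g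
      have hdiag : zpowDiagGL (n := 2) hϖ'.ne_zero a ∈ H := by
        have : zpowDiagGL (n := 2) hϖ'.ne_zero a = zpowDiagGL (n := 2) ϖ.ne_zero a := rfl
        rw [this, zpowDiagGL_two_eq]
        exact H.mul_mem (H.zpow_mem htH _) (H.zpow_mem hzH _)
      have hg' : g = k₁⁻¹ * (k₁ * g * k₂) * k₂⁻¹ := by group
      rw [hg', hg]
      exact H.mul_mem (H.mul_mem (H.inv_mem (hKH hk₁)) hdiag) (H.inv_mem (hKH hk₂))
    -- `N₂(F)` fixes `v`: every `n(x)` is a commutator `t n(y) t⁻¹ n(y)⁻¹`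
    have hϖ1 : (ϖ : F) - 1 ≠ 0 := by
      intro h
      have h1 : (ϖ : F) = 1 := sub_eq_zero.1 h
      have := hϖ.val_lt_one
      rw [h1, map_one] at this
      exact lt_irrefl _ this
    have hN : ∀ x : F,
        ρ ((unipotentGL2 x : ↥(upperUnitriangular (Fin 2) F)) : GL (Fin 2) F) v = v := by
      intro x
      set y : F := x / ((ϖ : F) - 1) with hy
      set u : GL (Fin 2) F := ((unipotentGL2 y : ↥(upperUnitriangular (Fin 2) F)) : GL (Fin 2) F)
        with hu_def
      have hx : ((unipotentGL2 x : ↥(upperUnitriangular (Fin 2) F)) : GL (Fin 2) F) =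
          t * u * t⁻¹ * u⁻¹ := by
        rw [ht_def, hu_def, heckeDiag_mul_unipotentGL2_mul_inv_mul_inv, hy, mul_div_cancel₀ _ hϖ1]
      obtain ⟨d, hd, hdu⟩ := hHmem.1 (hH u)
      have htinv : ρ t⁻¹ v = c⁻¹ • v := apply_inv_eq_inv_smul_of_apply_eq_smul ρ hc0 htv
      have huinv : ρ u⁻¹ v = d⁻¹ • v := apply_inv_eq_inv_smul_of_apply_eq_smul ρ hd hdu
      rw [hx, map_mul, map_mul, map_mul, Module.End.mul_apply, Module.End.mul_apply,
        Module.End.mul_apply, huinv, map_smul, map_smul, map_smul, htinv, map_smul, map_smul, hdu,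
        map_smul, htv, smul_smul, smul_smul, smul_smul]
      conv_rhs => rw [← one_smul ℂ v]
      congr 1
      field_simp
    -- a Whittaker functional then forces `ψ = 1`
    obtain ⟨Λ, hΛ, hΛ0⟩ := (isGeneric_iff ρ ψ).1 hgen
    have hΛv : Λ v ≠ 0 := by
      intro h0
      have hW : whittakerModel ρ Λ v = 0 := by
        funext g
        obtain ⟨d, -, hdg⟩ := hHmem.1 (hH g)
        rw [whittakerModel_apply, hdg, map_smul, h0, smul_zero, Pi.zero_apply]
      exact hv0 (whittakerModel_injective_of_ne_zero ρ hΛ0 (hW.trans (map_zero _).symm))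
    apply hψ.2
    refine AddChar.ext _ _ fun x => ?_
    have key := (mem_whittakerFunctionals_iff Λ).1 hΛ (unipotentGL2 x) v
    rw [hN x, whittakerCharFun_unipotentGL2] at key
    have h1 : ((ψ x : ℂ) - 1) * Λ v = 0 := by rw [sub_mul, one_mul, ← key, sub_self]
    rcases mul_eq_zero.1 h1 with h | h
    · rw [AddChar.zero_apply]
      exact Circle.coe_eq_one.1 (sub_eq_zero.1 h)
    · exact absurd h hΛv
  -- (5) read off the parameters
  obtain ⟨a', b', hab⟩ := Multiset.card_eq_two.1 hcard
  have he1v : α.esymm 1 = a' + b' := by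
    rw [hab]
    simp [Multiset.esymm, Multiset.powersetCard_one]
    exact add_comm _ _
  have he2v : α.esymm 2 = a' * b' := by
    rw [hab]
    simp [Multiset.esymm, Multiset.powersetCard_one, Multiset.powersetCard_cons]
  have he1bound : ‖a' + b'‖ < sq + sq⁻¹ := by
    have h := hstrict
    rw [hlam, norm_mul, Complex.norm_real, Real.norm_of_nonneg hsq0.le, he1v, hsq2] at h
    -- `h : sq * ‖a' + b'‖ < sq ^ 2 + 1`
    calc ‖a' + b'‖ = sq * ‖a' + b'‖ / sq := by field_simp
      _ < (sq ^ 2 + 1) / sq := div_lt_div_of_pos_right h hsq0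
      _ = sq + sq⁻¹ := by field_simp
  rw [he1v, he2v] at he1
  rw [he2v] at he2
  have hmem : a₀ = a' ∨ a₀ = b' := by
    rw [hab] at ha₀
    simpa using ha₀
  have hgoal : ‖a₀‖ < sq := by
    rcases hmem with rfl | rfl
    · exact norm_lt_of_norm_mul_eq_one_of_eq_mul_conj hsq1 he2 he1bound he1
    · refine norm_lt_of_norm_mul_eq_one_of_eq_mul_conj hsq1 (by rwa [mul_comm]) (by rwa [add_comm])
        ?_
      rw [add_comm a₀ a', mul_comm a₀ a']
      exact he1
  simpa [hsq_def, hq_def] using hgoal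

end RankTwo

end Literature.NumberTheory.Automorphic
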